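import Literature.Topology.FourManifolds.BoundaryPlanarisation
import Literature.Topology.FourManifolds.PairSaddleCover
import HarnessLib

/-!
# Planarisation of the boundary: the entrance sheets of the saddles and the core directions

Topic `Literature/Topology/FourManifolds` (support for the Torelli half of Griffiths' handlebody
theorem, `stmt-SmoothPoincare4-15190`, after `BoundaryPlanarisation.lean`; Dehn/wave part,
D1 second file).  Everything here is **proved**; the definitions are explicit flow maps.

Milnor, *Lectures on the h-cobordism theorem* (1965), proof of Thm. 3.12 (PDF p. 18): the
trajectories entering a Milnor box of a saddle `s` of index `1` cross the **entrance sheet**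
`{-x₁² + |y⃗|² = -ε²}` (two discs `x₁ = ±√(ε² + |y⃗|²)`, one for each end of the core); those on
the stable axis `y⃗ = 0` converge to `s`, all others pass and reach `L`.  For saddle data `Q` of a
pair of basin settings on a compact `3`-manifold with boundary we read the entrance sheets in the
planarisation of `BoundaryPlanarisation.lean`:

* `TracePolar.entPoint ε b y` — the point `(± √(ε² + ‖y‖²); y)` of the entrance sheet
  (`b = true`: the `+` end); `SaddleData.entW Q s b y` — the corresponding point of `W`, of level
  `c - ε²`, in the entrance set of width `δ` iff `‖y‖² < δ`;
* `SaddleData.entDir Q s b y = toChart (levelProj θ_A sphR (entW s b y))` — its direction on the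
  small level sphere at `p₀` (a vector of norm `rad`), smooth in `y`; `SaddleData.coreDir Q s b`
  (`y = 0`) — **the core directions**;
* `SaddleData.not_hits_ofChart_iff` — **a point of the small level sphere fails to reach `L` iff
  it is a core direction**: the planarisation is a bijection `∂W ∖ traces ≅ sphere ∖ (core
  directions)` (`BoundaryPlanarisation.planar_planarInv`), two core directions per saddle.

## References

* J. Milnor, *Lectures on the h-cobordism theorem* (1965), Def. 3.9, proof of Thm. 3.12, Thm. 4.1
  (PDF pp. 16–22). [MilnorHCobordism1965]
-/

open scoped Manifold ContDiff Topology
open Set Function Filter Metric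

noncomputable section

namespace Literature.Topology.FourManifolds

open Cobordism FourManifolds.Flow

universe u

namespace TracePolar

/-- Local notation for the model plane and space. -/
local notation "E2" => EuclideanSpace ℝ (Fin 2)
local notation "E3" => EuclideanSpace ℝ (Fin 3)

/-! ### The entrance sheet of the index-one model -/

/-- **The point `(± √(ε² + ‖y‖²); y)` of the entrance sheet `{-x₁² + |y⃗|² = -ε²}`.** [cite: MilnorHCobordism1965, proof of Thm. 3.12 (PDF p. 18)] -/
def entPoint (ε : ℝ) (b : Bool) (y : E2) : E3 := mk3 (boolSign b * Real.sqrt (ε ^ 2 + ‖y‖ ^ 2)) y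

/-- `entPoint_apply_zero`. [folklore] -/
theorem entPoint_apply_zero (ε : ℝ) (b : Bool) (y : E2) : entPoint ε b y 0 = boolSign b * Real.sqrt (ε ^ 2 + ‖y‖ ^ 2) := rfl

/-- `yv_entPoint`. [folklore] -/
@[simp] theorem yv_entPoint (ε : ℝ) (b : Bool) (y : E2) : yv (entPoint ε b y) = y := yv_mk3 _ _

/-- `|y⃗|²` of the entrance point. [folklore] -/
theorem sqSumGE_entPoint (ε : ℝ) (b : Bool) (y : E2) : sqSumGE 1 (entPoint ε b y) = ‖y‖ ^ 2 := by
  rw [sqSumGE_one, yv_entPoint]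

/-- `x₁²` of the entrance point is `ε² + ‖y‖²`. [folklore] -/
theorem sqSumLT_entPoint (ε : ℝ) (b : Bool) (y : E2) : sqSumLT 1 (entPoint ε b y) = ε ^ 2 + ‖y‖ ^ 2 := by
  rw [sqSumLT_one, entPoint_apply_zero, mul_pow, boolSign_sq', one_mul, Real.sq_sqrt (by positivity)]
where
  /-- `(±1)² = 1`. [folklore] -/
  boolSign_sq' (b : Bool) : boolSign b ^ 2 = 1 := by rw [sq, boolSign_mul_self]

/-- **The entrance point lies on the entrance sheet**: `Q₁ = -ε²`. [cite: MilnorHCobordism1965, proof of Thm. 3.12 (PDF p. 18)] -/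
theorem milnorQuadratic_entPoint (ε : ℝ) (b : Bool) (y : E2) : milnorQuadratic 1 (entPoint ε b y) = -ε ^ 2 := by
  rw [milnorQuadratic_eq, sqSumLT_entPoint, sqSumGE_entPoint]; ring

/-- The norm of the entrance point: `ε² + 2‖y‖²`. [folklore] -/
theorem norm_entPoint_sq (ε : ℝ) (b : Bool) (y : E2) : ‖entPoint ε b y‖ ^ 2 = ε ^ 2 + 2 * ‖y‖ ^ 2 := by
  rw [← sqSumLT_add_sqSumGE 1, sqSumLT_entPoint, sqSumGE_entPoint]; ring

/-- Entrance points with `‖y‖² < ε²` lie within `3ε` (indeed `√3 ε`). [folklore] -/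
theorem norm_entPoint_lt {ε : ℝ} (hε : 0 < ε) (b : Bool) {y : E2} (hy : ‖y‖ ^ 2 < ε ^ 2) : ‖entPoint ε b y‖ < 3 * ε := by
  have h := norm_entPoint_sq ε b y
  nlinarith [norm_nonneg (entPoint ε b y)]

/-- The entrance point is smooth in `y` (`ε ≠ 0`). [folklore] -/
theorem contDiff_entPoint {ε : ℝ} (hε : ε ≠ 0) (b : Bool) : ContDiff ℝ ∞ (entPoint ε b) := by
  have h1 : ContDiff ℝ ∞ (fun y : E2 => ε ^ 2 + ‖y‖ ^ 2) := contDiff_const.add (contDiff_norm_sq ℝ)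
  have h2 : ContDiff ℝ ∞ (fun y : E2 => Real.sqrt (ε ^ 2 + ‖y‖ ^ 2)) :=
    h1.sqrt fun y => by positivity
  have h3 : ContDiff ℝ ∞ (fun y : E2 => (boolSign b * Real.sqrt (ε ^ 2 + ‖y‖ ^ 2), y)) :=
    (contDiff_const.mul h2).prodMk contDiff_id
  exact contDiff_mk3.comp h3

/-- **An entrance-sheet point on the stable axis has `y⃗ = 0` and is `(±ε; 0)`.** [folklore] -/
theorem eq_entPoint_zero_of_sqSumGE_eq_zero {ε : ℝ} (hε : 0 < ε) {u : E3} (hQ : milnorQuadratic 1 u = -ε ^ 2)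
    (hB : sqSumGE 1 u = 0) : ∃ b : Bool, u = entPoint ε b 0 := by
  have hy : yv u = 0 := by
    rw [sqSumGE_one] at hB
    exact norm_eq_zero.1 (pow_eq_zero_iff two_ne_zero |>.1 hB)
  have hx : u 0 ^ 2 = ε ^ 2 := by rw [milnorQuadratic_one, hy, norm_zero] at hQ; nlinarith
  have hcases : u 0 = ε ∨ u 0 = -ε := by
    have : (u 0 - ε) * (u 0 + ε) = 0 := by nlinarith
    rcases mul_eq_zero.1 this with h | h
    · exact Or.inl (by linarith)
    · exact Or.inr (by linarith)
  rcases hcases with h | h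
  · refine ⟨true, ?_⟩
    rw [← mk3_zero_yv u, hy, h, entPoint]
    simp [Real.sqrt_sq hε.le]
  · refine ⟨false, ?_⟩
    rw [← mk3_zero_yv u, hy, h, entPoint]
    simp [Real.sqrt_sq hε.le]

end TracePolar

/-! ### The entrance sheets of the saddles and the core directions -/

namespace BasinPair

namespace SaddleData

open TracePolar

variable {W : Type u} [TopologicalSpace W] [T2Space W] [SecondCountableTopology W]
  [CompactSpace W] [ChartedSpace (EuclideanHalfSpace (2 + 1)) W] [IsManifold (𝓡∂ (2 + 1)) ∞ W]
  {g : W → ℝ} {ξA ξB : Π x : W, TangentSpace (𝓡∂ (2 + 1)) x} {P : BasinPair g ξA ξB}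
  (Q : P.SaddleData)

/-- Local notation for the model plane and space. -/
local notation "E2" => EuclideanSpace ℝ (Fin 2)
local notation "E3" => EuclideanSpace ℝ (Fin 3)

/-- **The entrance-sheet point of the saddle `s`** at the end `b` with transverse coordinate `y`. [cite: MilnorHCobordism1965, proof of Thm. 3.12 (PDF p. 18)] -/
def entW (s : SaddlePt 2 g) (b : Bool) (y : E2) : W :=
  ((Q.DA s).chart.extend (𝓡∂ (2 + 1))).symm ((Q.DA s).center + entPoint Q.ε b y)

/-- **The direction on the small level sphere** of the trajectory through the entrance-sheet
point. [cite: MilnorHCobordism1965, Def. 3.9, Thm. 4.1] -/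
def entDir (s : SaddlePt 2 g) (b : Bool) (y : E2) : E3 := P.A.toChart (levelProj P.A.θ g P.A.sphR (Q.entW s b y))

/-- **The core directions**: the directions of the two ends of the core of `s` on the small level
sphere. [cite: MilnorHCobordism1965, Def. 3.9] -/
def coreDir (s : SaddlePt 2 g) (b : Bool) : E3 := Q.entDir s b 0

/-- The entrance level `c - ε²`. [folklore] -/
def entLevel : ℝ := Q.c - Q.ε ^ 2

variable {Q}

/-- `entLevel_def`. [folklore] -/
theorem entLevel_def : Q.entLevel = Q.c - Q.ε ^ 2 := rfl

/-- The entrance level lies in `(sphR, c)`, `(g p₀, hi)`, and below `L`. [folklore] -/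
theorem sphR_lt_entLevel : P.A.sphR < Q.entLevel := P.A.sphR_lt_sph.trans Q.sph_lt_c_sub_sq

/-- `entLevel_mem_Ioo`. [folklore] -/
theorem entLevel_mem_Ioo : Q.entLevel ∈ Ioo (g P.A.p₀) P.A.hi :=
  ⟨Q.apply_p₀_lt_c_sub_sq, (sub_lt_self _ Q.sq_pos).trans Q.c_lt_hi⟩

/-- `entLevel_lt_c`. [folklore] -/
theorem entLevel_lt_c : Q.entLevel < Q.c := sub_lt_self _ Q.sq_pos

section Ent

variable {s : SaddlePt 2 g} (hk : (Q.DA s).k = 1) {b : Bool} {y : E2}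

include hk

omit hk in
/-- **The entrance-sheet point lies in the `3ε`-ball with coordinates `entPoint ε b y`** (`‖y‖² < ε²`). [folklore] -/
theorem entW_mem_chartBall (hy : ‖y‖ ^ 2 < Q.ε ^ 2) :
    Q.entW s b y ∈ (Q.DA s).chartBall (3 * Q.ε) ∧ (Q.DA s).coord (Q.entW s b y) = entPoint Q.ε b y := by
  have hn : ‖entPoint Q.ε b y‖ < 3 * (Q.DA s).ε := by rw [Q.εA]; exact norm_entPoint_lt Q.ε_pos b hy
  have h1 := (Q.DA s).symm_add_mem_chartBall le_rfl hn
  rw [Q.εA] at h1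
  exact ⟨h1, (Q.DA s).coord_symm_add (by rw [Q.εA] at hn ⊢; exact hn.le)⟩

/-- **The entrance-sheet point has level `c - ε²`.** [cite: MilnorHCobordism1965, proof of Thm. 3.12] -/
theorem apply_entW (hy : ‖y‖ ^ 2 < Q.ε ^ 2) : g (Q.entW s b y) = Q.entLevel := by
  obtain ⟨hb, hc⟩ := entW_mem_chartBall (Q := Q) (s := s) (b := b) hy
  rw [Q.apply_eq_of_mem_chartBall hb, hc, hk, milnorQuadratic_entPoint, entLevel]; ring

/-- The entrance-sheet point is non-critical, of level in `(g p₀, hi)`. [folklore] -/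
theorem not_isMCriticalPt_entW (hy : ‖y‖ ^ 2 < Q.ε ^ 2) : ¬ IsMCriticalPt (𝓡∂ (2 + 1)) g (Q.entW s b y) :=
  Q.not_isMCriticalPt_of_apply (by rw [apply_entW hk hy]; exact entLevel_mem_Ioo.1)
    (by rw [apply_entW hk hy]; exact entLevel_lt_c.ne)

/-- The entrance-sheet point lies in the entrance set of width `δ` iff `‖y‖² < δ` (`‖y‖² < ε²`). [folklore] -/
theorem entW_mem_Uent_iff (hy : ‖y‖ ^ 2 < Q.ε ^ 2) {δ : ℝ} : Q.entW s b y ∈ Q.Uent s δ ↔ ‖y‖ ^ 2 < δ := by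
  obtain ⟨hball, hc⟩ := entW_mem_chartBall (Q := Q) (s := s) (b := b) hy
  rw [mem_Uent_iff, hc, hk, sqSumGE_entPoint]
  exact ⟨fun h => h.2, fun h => ⟨hball, h⟩⟩

/-- **The trajectory of an entrance-sheet point meets the small level sphere** (backward: the
only critical value below `c - ε²` is `g p₀ < sphR`). [cite: MilnorHCobordism1965, Thm. 4.1 (PDF p. 22)] -/
theorem hits_sphR_entW (hy : ‖y‖ ^ 2 < Q.ε ^ 2) : Hits P.A.θ g P.A.sphR (Q.entW s b y) := by
  refine P.A.hits_of_ge (by rw [apply_entW hk hy]; exact entLevel_mem_Ioo.2.le)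
    (by rw [apply_entW hk hy]; exact sphR_lt_entLevel.le) P.A.sphR_mem_Ioo_lo.1 ?_
  rw [apply_entW hk hy]
  exact Q.forall_apply_not_mem_Icc P.A.sphR_mem_Ioo.1 fun h => (not_le.2 entLevel_lt_c) h.2

/-- **The entrance-sheet point at `y = 0` (on the core) never reaches `L`.** [cite: MilnorHCobordism1965, proof of Thm. 3.12 (PDF p. 18)] -/
theorem not_hits_L_entW_zero : ¬ Hits P.A.θ g P.A.L (Q.entW s b 0) := by
  have hy : ‖(0 : E2)‖ ^ 2 < Q.ε ^ 2 := by rw [norm_zero]; simpa using Q.sq_pos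
  obtain ⟨hball, hc⟩ := entW_mem_chartBall (Q := Q) (s := s) (b := b) hy
  refine Q.not_hits_of_sqSumGE_eq_zero hball ?_ Q.c_lt_L
  rw [hc, hk, sqSumGE_entPoint, norm_zero]; ring

/-- The direction vector has norm `rad`. [folklore] -/
theorem norm_entDir (hy : ‖y‖ ^ 2 < Q.ε ^ 2) : ‖Q.entDir s b y‖ = P.A.rad :=
  (P.A.norm_toChart_eq_rad_iff (by rw [P.A.apply_levelProj (hits_sphR_entW hk hy)]; exact P.A.sphR_le_sph)).2
    (P.A.apply_levelProj (hits_sphR_entW hk hy))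

/-- The chart point of the direction vector is the level point. [folklore] -/
theorem ofChart_entDir (hy : ‖y‖ ^ 2 < Q.ε ^ 2) :
    P.A.ofChart (Q.entDir s b y) = levelProj P.A.θ g P.A.sphR (Q.entW s b y) :=
  P.A.ofChart_toChart (P.A.mem_source_of_apply_le (by rw [P.A.apply_levelProj (hits_sphR_entW hk hy)]; exact P.A.sphR_le_sph))

/-- **The chart point of a core direction never reaches `L`** (it lies on the core). [cite: MilnorHCobordism1965, Def. 3.9, proof of Thm. 3.12] -/
theorem not_hits_L_ofChart_coreDir : ¬ Hits P.A.θ g P.A.L (P.A.ofChart (Q.coreDir s b)) := by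
  have hy : ‖(0 : E2)‖ ^ 2 < Q.ε ^ 2 := by rw [norm_zero]; simpa using Q.sq_pos
  rw [coreDir, ofChart_entDir hk hy, levelProj_apply, P.A.hits_θ_iff]
  exact not_hits_L_entW_zero hk

/-- **The direction map is smooth** (`‖y‖² < ε²`). [cite: MilnorHCobordism1965, proof of Thm. 5.4, Assertion 4 (PDF p. 29)] -/
theorem contMDiffAt_entDir (hy : ‖y‖ ^ 2 < Q.ε ^ 2) : ContMDiffAt 𝓘(ℝ, E2) 𝓘(ℝ, E3) ∞ (Q.entDir s b) y := by
  have hn : ‖entPoint Q.ε b y‖ < 3 * (Q.DA s).ε := by rw [Q.εA]; exact norm_entPoint_lt Q.ε_pos b hy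
  have h1 : ContMDiffAt 𝓘(ℝ, E2) 𝓘(ℝ, E3) ∞ (fun y => (Q.DA s).center + entPoint Q.ε b y) y :=
    contMDiffAt_const.add (contDiff_entPoint Q.ε_pos.ne' b).contDiffAt.contMDiffAt
  have hc : (Q.DA s).center + entPoint Q.ε b y ∈ ball ((Q.DA s).chart.extend (𝓡∂ (2 + 1)) s.1) (3 * (Q.DA s).ε) := by
    rw [mem_ball, dist_eq_norm, MilnorBox.center, add_sub_cancel_left]; exact hn
  have h2 : ContMDiffAt 𝓘(ℝ, E2) (𝓡∂ (2 + 1)) ∞ (Q.entW s b) y := ((Q.DA s).contMDiffAt_extend_symm hc).comp y h1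
  have h3 : ContMDiffAt (𝓡∂ (2 + 1)) (𝓡∂ (2 + 1)) ∞ (levelProj P.A.θ g P.A.sphR) (Q.entW s b y) :=
    P.A.contMDiffAt_levelProj (P.A.apply_mem_slab (by rw [apply_entW hk hy]; exact entLevel_mem_Ioo.2))
      (not_isMCriticalPt_entW hk hy) P.A.sphR_mem_Ioo_lo (hits_sphR_entW hk hy)
  have h4 : ContMDiffAt (𝓡∂ (2 + 1)) 𝓘(ℝ, E3) ∞ P.A.toChart (levelProj P.A.θ g P.A.sphR (Q.entW s b y)) :=
    P.A.contMDiffAt_toChart (P.A.mem_source_of_apply_le (by rw [P.A.apply_levelProj (hits_sphR_entW hk hy)]; exact P.A.sphR_le_sph))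
  exact h4.comp y (h3.comp y h2)

/-- **The direction map is injective** on `{‖y‖² < ε²}` (distinct entrance points on one level lie
on distinct trajectories). [folklore] -/
theorem entDir_injOn : InjOn (Q.entDir s b) {y : E2 | ‖y‖ ^ 2 < Q.ε ^ 2} := by
  intro y hy y' hy' h
  have h1 : levelProj P.A.θ g P.A.sphR (Q.entW s b y) = levelProj P.A.θ g P.A.sphR (Q.entW s b y') := by
    rw [← ofChart_entDir hk hy, ← ofChart_entDir hk hy', h]
  -- both entrance points are the level points at `c - ε²` of the common low point
  have key : ∀ {y₀ : E2}, ‖y₀‖ ^ 2 < Q.ε ^ 2 →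
      levelProj P.A.θ g Q.entLevel (levelProj P.A.θ g P.A.sphR (Q.entW s b y₀)) = Q.entW s b y₀ := fun {y₀} hy₀ => by
    rw [P.A.levelProj_levelProj (not_isMCriticalPt_entW hk hy₀) _ (P.A.Ioo_subset_slab entLevel_mem_Ioo)
      ⟨0, by rw [P.A.θ_zero]; exact apply_entW hk hy₀⟩]
    exact P.A.levelProj_eq_self (not_isMCriticalPt_entW hk hy₀) (P.A.Ioo_subset_slab entLevel_mem_Ioo) (apply_entW hk hy₀)
  have h2 : Q.entW s b y = Q.entW s b y' := by rw [← key hy, ← key hy', h1]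
  have h3 := congrArg (Q.DA s).coord h2
  rw [(entW_mem_chartBall (Q := Q) (s := s) (b := b) hy).2, (entW_mem_chartBall (Q := Q) (s := s) (b := b) hy').2] at h3
  have h4 := congrArg yv h3
  rwa [yv_entPoint, yv_entPoint] at h4

end Ent

/-! ### The exceptional set: points of the small level sphere not reaching `L` are core directions -/

/-- **A point of the small level sphere whose ray does not reach `L` is a core direction.** [cite: MilnorHCobordism1965, Def. 3.9, proof of Thm. 3.12, Thm. 4.1] -/
theorem exists_eq_coreDir_of_not_hits (hk : ∀ s, (Q.DA s).k = 1) {v : E3} (hv : ‖v‖ = P.A.rad)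
    (hnot : ¬ Hits P.A.θ g P.A.L (P.A.ofChart v)) : ∃ s b, v = Q.coreDir s b := by
  have hvr : ‖v‖ < P.A.r₀ := P.A.norm_lt_r₀_of_eq_rad hv
  set x := P.A.ofChart v with hx
  have hgx : g x = P.A.sphR := (P.A.apply_ofChart_eq_sphR_iff hvr.le).2 hv
  have hxI : g x ∈ Ioo (g P.A.p₀) P.A.hi := by rw [hgx]; exact P.A.sphR_mem_Ioo
  have hxc : ¬ IsMCriticalPt (𝓡∂ (2 + 1)) g x :=
    Q.not_isMCriticalPt_of_apply hxI.1 (by rw [hgx]; exact (P.A.sphR_lt_sph.trans Q.sph_lt_c).ne)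
  -- the entrance domain of width `ε²` determines the saddle
  obtain ⟨s, hs⟩ := Q.exists_mem_dom_refEnt_of_not_hits hxI hxc hnot Q.sq_pos
  set z := levelProj P.A.θ g Q.entLevel x with hz
  have hzU : z ∈ Q.Uent s (Q.ε ^ 2) := (Q.mem_dom_refEnt_iff.1 hs).2.2.2
  -- `|y⃗|²` of `z` is below every positive width, hence zero
  have hB : sqSumGE (Q.DA s).k ((Q.DA s).coord z) = 0 := by
    refine le_antisymm (le_of_forall_pos_lt_add fun δ hδ => ?_) (sqSumGE_nonneg _ _)
    obtain ⟨s', hs'⟩ := Q.exists_mem_dom_refEnt_of_not_hits hxI hxc hnot hδ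
    have hss : s = s' := Q.eq_of_mem_dom_refEnt_of_mem_dom_refEnt hs hs'
    subst hss
    have h : sqSumGE (Q.DA s).k ((Q.DA s).coord z) < δ := (Q.mem_dom_refEnt_iff.1 hs').2.2.2.2
    linarith
  -- so `z` is an end of the core on the entrance sheet
  have hzlev : g z = Q.entLevel := P.A.apply_levelProj (Q.mem_dom_refEnt_iff.1 hs).2.2.1
  have hQz : milnorQuadratic 1 ((Q.DA s).coord z) = -Q.ε ^ 2 := by
    have h := Q.apply_eq_of_mem_chartBall hzU.1
    rw [hzlev, entLevel, hk s] at h; linarith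
  obtain ⟨b, hb⟩ := eq_entPoint_zero_of_sqSumGE_eq_zero Q.ε_pos hQz (by have h := hB; rw [hk s] at h; exact h)
  have hzW : z = Q.entW s b 0 := by
    rw [entW, ← hb]; exact ((Q.DA s).symm_add_coord_of_mem_chartBall hzU.1).symm
  refine ⟨s, b, ?_⟩
  -- the low point of `entW s b 0` is `x`
  have h1 : levelProj P.A.θ g P.A.sphR z = x := by
    rw [hz, P.A.levelProj_levelProj hxc _ (P.A.Ioo_subset_slab P.A.sphR_mem_Ioo) ⟨0, by rw [P.A.θ_zero]; exact hgx⟩]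
    exact P.A.levelProj_eq_self hxc (P.A.Ioo_subset_slab P.A.sphR_mem_Ioo) hgx
  rw [coreDir, entDir, ← hzW, h1, hx, P.A.toChart_ofChart hvr.le]

/-- **The exceptional set of the planarisation**: a point of the small level sphere fails to reach
`L` along its ray iff it is a core direction. [cite: MilnorHCobordism1965, Def. 3.9, proof of Thm. 3.12, Thm. 4.1] -/
theorem not_hits_ofChart_iff (hk : ∀ s, (Q.DA s).k = 1) {v : E3} (hv : ‖v‖ = P.A.rad) :
    ¬ Hits P.A.θ g P.A.L (P.A.ofChart v) ↔ ∃ s b, v = Q.coreDir s b := by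
  refine ⟨exists_eq_coreDir_of_not_hits hk hv, ?_⟩
  rintro ⟨s, b, rfl⟩
  exact not_hits_L_ofChart_coreDir (hk s)

/-- The core directions have norm `rad`. [folklore] -/
theorem norm_coreDir {s : SaddlePt 2 g} (hk : (Q.DA s).k = 1) (b : Bool) : ‖Q.coreDir s b‖ = P.A.rad :=
  norm_entDir hk (by rw [norm_zero]; simpa using Q.sq_pos)


/-- **The core directions are pairwise distinct**: two per saddle. [cite: MilnorHCobordism1965, Def. 3.9] -/
theorem coreDir_injective (hk : ∀ s, (Q.DA s).k = 1) {s s' : SaddlePt 2 g} {b b' : Bool}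
    (h : Q.coreDir s b = Q.coreDir s' b') : s = s' ∧ b = b' := by
  have hy : ‖(0 : E2)‖ ^ 2 < Q.ε ^ 2 := by rw [norm_zero]; simpa using Q.sq_pos
  -- the entrance points coincide
  have key : ∀ (s₀ : SaddlePt 2 g) (b₀ : Bool),
      levelProj P.A.θ g Q.entLevel (P.A.ofChart (Q.coreDir s₀ b₀)) = Q.entW s₀ b₀ 0 := fun s₀ b₀ => by
    rw [coreDir, ofChart_entDir (hk s₀) hy,
      P.A.levelProj_levelProj (not_isMCriticalPt_entW (hk s₀) hy) _ (P.A.Ioo_subset_slab entLevel_mem_Ioo)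
        ⟨0, by rw [P.A.θ_zero]; exact apply_entW (hk s₀) hy⟩]
    exact P.A.levelProj_eq_self (not_isMCriticalPt_entW (hk s₀) hy) (P.A.Ioo_subset_slab entLevel_mem_Ioo) (apply_entW (hk s₀) hy)
  have h1 : Q.entW s b 0 = Q.entW s' b' 0 := by rw [← key s b, ← key s' b', h]
  have hss : s = s' := by
    by_contra hne
    have hz := (entW_mem_chartBall (Q := Q) (s := s) (b := b) hy).1.1
    have hz' := (entW_mem_chartBall (Q := Q) (s := s') (b := b') hy).1.1
    rw [h1] at hz
    exact Set.disjoint_left.1 (Q.disjA s s' hne) hz hz'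
  subst hss
  refine ⟨rfl, ?_⟩
  have h2 := congrArg (Q.DA s).coord h1
  rw [(entW_mem_chartBall (Q := Q) (s := s) (b := b) hy).2, (entW_mem_chartBall (Q := Q) (s := s) (b := b') hy).2] at h2
  have h3 := congrArg (fun u : E3 => u 0) h2
  simp only [entPoint_apply_zero, norm_zero] at h3
  have hε := Q.ε_pos
  have h4 : Real.sqrt (Q.ε ^ 2 + 0 ^ 2) = Q.ε := by rw [zero_pow two_ne_zero, add_zero, Real.sqrt_sq hε.le]
  rw [h4] at h3
  have h5 : boolSign b = boolSign b' := mul_right_cancel₀ hε.ne' h3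
  cases b <;> cases b' <;> simp at h5 ⊢ <;> linarith

variable [Nonempty (BoundaryManifold.boundaryData 2 W).carrier]

/-- **The range of the planarisation is the small level sphere minus the core directions.** [cite: MilnorHCobordism1965, Def. 3.9, Thm. 4.1] -/
theorem mem_range_planar_iff (hk : ∀ s, (Q.DA s).k = 1) {v : E3} :
    v ∈ P.A.planar '' P.A.planarDom ↔ ‖v‖ = P.A.rad ∧ ∀ s b, v ≠ Q.coreDir s b := by
  constructor
  · rintro ⟨y, hy, rfl⟩
    refine ⟨BasinSetting.norm_planar hy, fun s b h => ?_⟩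
    have h1 : Hits P.A.θ g P.A.L (P.A.ofChart (P.A.planar y)) := by
      rw [BasinSetting.ofChart_planar hy, BasinSetting.low, levelProj_apply, P.A.hits_θ_iff]
      exact P.A.hits_L_of_L_le (by rw [P.A.apply_push_coe]) (by rw [P.A.apply_push_coe]; exact P.A.L_lt_hi.le)
    rw [h] at h1
    exact not_hits_L_ofChart_coreDir (hk s) h1
  · rintro ⟨hv, hne⟩
    have hhit : Hits P.A.θ g P.A.L (P.A.ofChart v) := by
      by_contra h
      obtain ⟨s, b, hsb⟩ := exists_eq_coreDir_of_not_hits hk hv h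
      exact hne s b hsb
    obtain ⟨h1, h2⟩ := BasinSetting.planar_planarInv hv hhit
    exact ⟨_, h2, h1⟩

end SaddleData

end BasinPair

end Literature.Topology.FourManifolds
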